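import Mathlib
import Literature.NumberTheory.LFunctions.Zhang2022.TypedSection10C
import Literature.NumberTheory.LFunctions.Zhang2022.Section10MainTerms
import Literature.NumberTheory.LFunctions.Zhang2022.Section10Theta1Evals
import Literature.NumberTheory.LFunctions.Zhang2022.Section10cGather1422
import HarnessLib

/-!
# Zhang (2022) §10c, discharged bookkeeping IV: the change of variables `x = P^z` in the low range
# of `S_j(𝐚₁₂,𝐚₁₄)` with the replacement `𝔣_{jμ}(P^w) ↦ 𝔣𝔣_{jμ}(w)` (DAG node Z22:§10.u055 (iii))

Topic `Literature/NumberTheory/LFunctions/Zhang2022` (Landau–Siegel audit tree; verdict-neutral).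
Y. Zhang, *Discrete mean estimates and the Landau–Siegel zero*, arXiv:2211.02515v1 (2022)
[Zhang2022LandauSiegel], §10 p. 60 (tex L3081, second → third line) and §8 p. 49 ("`𝔣_{jμ}(P^z) = 𝔣𝔣_{jμ}(z)
+ O(𝓛⁻⁸)`") — **an unrefereed manuscript under adjudication; this file asserts nothing about its
Theorems 1–2.** D-0069 campaign, discharge layer L3 (seat sz-d34).

What is PROVED here (kernel-checked; interval-integral calculus and the algebra of the shifts
(2.13), (2.22); no analytic number theory):

| DAG node | locator | theorem | content |
|---|---|---|---|
| §8 p.49 input | tex L2493ff | `frakf_sub_ffF`, `norm_frakf_sub_ffJ` | with the ACTUAL shifts `β_j` of (2.13), `𝔣(β_j,β_μ; w log P) − 𝔣𝔣_{jμ}(w) = −s_jw·e^{β_μ w log P}`, `‖·‖ ≤ 5π|c′α𝓛|·|w|` (`μ = 6, 7`; `β₆log P = 3πi/2`, `β₇log P = 5πi/2` exactly) |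
| `Z22:§10.u055` (ii)→(iii), exact part | p.60, tex L3081 | `lowX1214_eq_z` | `∫₁^{P^{0.496}}(…)(P^{0.498}/x, P^{0.5}/x)dx/x = log P·∫₀^{0.496}(…)((0.002+z)log P, (0.004+z)log P)dz` (substitution `x = P^z` and reflection `z ↦ 0.496 − z`) |
| `Z22:§10.u055` (iii) | p.60, tex L3081 | `low1214Int_holds : Low1214Int c′` | "`… = (𝔞β_{j+1}β_{j+2}log P/500)∫₀^{0.496}(ῑ₃𝔣𝔣_{j6}(0.002+z)/0.498 + ῑ₄𝔣𝔣_{j7}(0.004+z)/0.5)dz + o(α)`" HOLDS (unconditionally in (A)) |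

The `o(α)`: the replacement costs `≤ 18π|c′α𝓛|` pointwise on `[0, 0.496]`, the prefactor has norm
`𝔞·n_jα²|1+E_j|·(π/α)/500 ≤ (6π/500)𝔞α(1+E₀)` (`betaJ_pair`), and `𝔞 ≤ K𝓛⁴` (the tree's
`Skeleton.frakA_le_ell_pow_four`), `α𝓛 = π𝓛⁻⁸`, so the difference is `≤ C(c′)·α·𝓛⁻⁴ ≤ εα` for
`𝓛 ≥ C(c′)/ε + 1`.

## References

* Y. Zhang, arXiv:2211.02515v1 (2022), §10 p. 60; §8 p. 49, (8.13)–(8.18); §2 (2.13), (2.22), (2.26).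
  [cite: Zhang2022LandauSiegel, §10 p. 60]
-/

noncomputable section

open Complex Real ComplexConjugate
open Literature.NumberTheory.LFunctions.Zhang2022.Skeleton

namespace Literature.NumberTheory.LFunctions.Zhang2022.Typed.Sec10C

section D34Low1214Int

/-- `frakf` is continuous in its real log-argument. [cite: Zhang2022LandauSiegel, §8 Lemma 8.2] -/
@[fun_prop] theorem continuous_frakf_comp (β βμ L : ℂ) (a : ℝ) :
    Continuous fun z : ℝ => frakf β βμ (L * (((a + z : ℝ)) : ℂ)) := by
  unfold frakf; fun_prop

/-- The algebra of "`𝔣_{jμ}(P^w) = 𝔣𝔣_{jμ}(w) + O(𝓛⁻⁸)`": if `β_μ log P = kπi` exactly and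
`β_j log P = (k − a)πi + s`, then `𝔣(β_j, β_μ; w log P) − 𝔣𝔣_{a,k}(w) = −sw·e^{kπiw}`.
[cite: Zhang2022LandauSiegel, §8 p. 49] -/
theorem frakf_sub_ffF (a k : ℚ) (β βμ L s : ℂ) (w : ℝ) (hμ : βμ * L = k * π * I)
    (hβ : β * L = ((k : ℂ) - a) * π * I + s) :
    frakf β βμ (L * w) - ffF a k w = -(s * w) * cexp (k * π * I * w) := by
  have h1 : βμ * (L * w) = k * π * I * w := by rw [← mul_assoc, hμ]
  have h2 : (βμ - β) * (L * w) = (a * π * I - s) * w := by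
    rw [← mul_assoc, sub_mul, hμ, hβ]; ring
  unfold frakf ffF
  rw [h2, h1]
  ring

/-- `‖−sw·e^{kπiw}‖ = ‖s‖|w|`. [folklore] -/
private theorem norm_err_term (s : ℂ) (k : ℚ) (w : ℝ) :
    ‖-(s * w) * cexp (k * π * I * w)‖ = ‖s‖ * |w| := by
  have : cexp (k * π * I * w) = cexp (((k * π * w : ℝ)) * I) := by push_cast; ring_nf
  rw [norm_mul, norm_neg, norm_mul, this, Complex.norm_exp_ofReal_mul_I, Complex.norm_real,
    Real.norm_eq_abs, mul_one]

/-- `β₆ log P = 3πi/2` and `β₇ log P = 5πi/2` exactly (`α log P = π`).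
[cite: Zhang2022LandauSiegel, §2 (2.22)] -/
theorem beta67_mul_log {D : ℕ} (hΛ : 0 < Real.log (bigP D)) :
    beta6 D * (Real.log (bigP D) : ℂ) = ((3 / 2 : ℚ) : ℂ) * π * I ∧
      beta7 D * (Real.log (bigP D) : ℂ) = ((5 / 2 : ℚ) : ℂ) * π * I := by
  have hΛ0 : (Real.log (bigP D) : ℂ) ≠ 0 := by exact_mod_cast hΛ.ne'
  have hα : (alpha D : ℂ) = π / (Real.log (bigP D) : ℂ) := by rw [alpha, Complex.ofReal_div]
  constructor
  · rw [beta6, hα]; push_cast; field_simp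
  · rw [beta7, hα]; push_cast; field_simp

/-- **"`𝔣_{jμ}(P^w) = 𝔣𝔣_{jμ}(w) + O(𝓛⁻⁸)`" made exact** (§8 p. 49, used in §10 p. 60): with the
ACTUAL shifts `β_j` of (2.13) (including the `c′α𝓛`-corrections) and `μ = 6, 7`,
`‖𝔣(β_j, β_μ; w·log P) − 𝔣𝔣_{jμ}(w)‖ ≤ 5π|c′α𝓛|·|w|` for `j = 1, 2, 3` (`β_j log P = jπi(1 + σ_ju)`,
`σ = −5, 1, −1`, `u = c′α𝓛`). [cite: Zhang2022LandauSiegel, §8 p. 49] -/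
theorem norm_frakf_sub_ffJ {c' : ℝ} {D : ℕ} (hΛ : 0 < Real.log (bigP D)) {j : ℕ}
    (hj : j ∈ ({1, 2, 3} : Finset ℕ)) (w : ℝ) :
    ‖frakf (betaJ c' D j) (beta6 D) ((Real.log (bigP D) : ℂ) * w) - ffJ6 j w‖ ≤
        5 * π * |c' * alpha D * ell D| * |w| ∧
      ‖frakf (betaJ c' D j) (beta7 D) ((Real.log (bigP D) : ℂ) * w) - ffJ7 j w‖ ≤
        5 * π * |c' * alpha D * ell D| * |w| := by
  have hΛ0 : (Real.log (bigP D) : ℂ) ≠ 0 := by exact_mod_cast hΛ.ne'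
  have hα : (alpha D : ℂ) = π / (Real.log (bigP D) : ℂ) := by rw [alpha, Complex.ofReal_div]
  obtain ⟨h6, h7⟩ := beta67_mul_log hΛ
  set u : ℝ := c' * alpha D * ell D with hu
  have hu' : (c' : ℂ) * alpha D * ell D = u := by rw [hu]; push_cast; ring
  have hπ : 0 ≤ π := Real.pi_pos.le
  -- `β_j log P = jπi + jσ_jπi·u`
  have key : ∀ (σ : ℝ) (hσ : (j : ℝ) * |σ| ≤ 5) (β : ℂ)
      (hβ : β * (Real.log (bigP D) : ℂ) = (j : ℂ) * π * I + (j * σ * π * u : ℝ) * I)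
      (hj0 : 0 ≤ (j : ℝ)) (a6 a7 : ℚ) (ha6 : (a6 : ℝ) = 3 / 2 - j)
      (ha7 : (a7 : ℝ) = 5 / 2 - j),
      ‖frakf β (beta6 D) ((Real.log (bigP D) : ℂ) * w) - ffF a6 (3 / 2) w‖ ≤ 5 * π * |u| * |w| ∧
        ‖frakf β (beta7 D) ((Real.log (bigP D) : ℂ) * w) - ffF a7 (5 / 2) w‖ ≤
          5 * π * |u| * |w| := by
    intro σ hσ β hβ hj0 a6 a7 ha6 ha7
    have hs : ‖((j * σ * π * u : ℝ) : ℂ) * I‖ ≤ 5 * π * |u| := by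
      rw [norm_mul, Complex.norm_I, mul_one, Complex.norm_real, Real.norm_eq_abs, abs_mul, abs_mul,
        abs_mul, abs_of_nonneg hπ, abs_of_nonneg hj0]
      calc (j : ℝ) * |σ| * π * |u| = ((j : ℝ) * |σ|) * (π * |u|) := by ring
        _ ≤ 5 * (π * |u|) := mul_le_mul_of_nonneg_right hσ (by positivity)
        _ = 5 * π * |u| := by ring
    have hβ6 : β * (Real.log (bigP D) : ℂ) = (((3 / 2 : ℚ) : ℂ) - a6) * π * I +
        ((j * σ * π * u : ℝ) : ℂ) * I := by
      rw [hβ]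
      have : ((a6 : ℝ) : ℂ) = ((3 / 2 - j : ℝ) : ℂ) := by rw [ha6]
      push_cast at this ⊢
      rw [this]; ring
    have hβ7 : β * (Real.log (bigP D) : ℂ) = (((5 / 2 : ℚ) : ℂ) - a7) * π * I +
        ((j * σ * π * u : ℝ) : ℂ) * I := by
      rw [hβ]
      have : ((a7 : ℝ) : ℂ) = ((5 / 2 - j : ℝ) : ℂ) := by rw [ha7]
      push_cast at this ⊢
      rw [this]; ring
    constructor
    · rw [frakf_sub_ffF a6 (3 / 2) β (beta6 D) _ _ w h6 hβ6, norm_err_term]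
      exact mul_le_mul_of_nonneg_right hs (abs_nonneg w)
    · rw [frakf_sub_ffF a7 (5 / 2) β (beta7 D) _ _ w h7 hβ7, norm_err_term]
      exact mul_le_mul_of_nonneg_right hs (abs_nonneg w)
  simp only [Finset.mem_insert, Finset.mem_singleton] at hj
  rcases hj with rfl | rfl | rfl
  · have hβ : betaJ c' D 1 * (Real.log (bigP D) : ℂ) =
        ((1 : ℕ) : ℂ) * π * I + (((1 : ℕ) * (-5 : ℝ) * π * (c' * alpha D * ell D) : ℝ) : ℂ) * I := by
      simp only [betaJ, beta1]
      norm_num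
      rw [hα]; field_simp; ring
    simpa [ffJ6, ffJ7, byJ, ff16, ff17] using
      key (-5) (by norm_num) _ hβ (by norm_num) (1/2) (3/2) (by norm_num) (by norm_num)
  · have hβ : betaJ c' D 2 * (Real.log (bigP D) : ℂ) =
        ((2 : ℕ) : ℂ) * π * I + (((2 : ℕ) * (1 : ℝ) * π * (c' * alpha D * ell D) : ℝ) : ℂ) * I := by
      simp only [betaJ, beta2]
      norm_num
      rw [hα]; field_simp
    simpa [ffJ6, ffJ7, byJ, ff26, ff27] using
      key 1 (by norm_num) _ hβ (by norm_num) (-1/2) (1/2) (by norm_num) (by norm_num)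
  · have hβ : betaJ c' D 3 * (Real.log (bigP D) : ℂ) =
        ((3 : ℕ) : ℂ) * π * I + (((3 : ℕ) * (-1 : ℝ) * π * (c' * alpha D * ell D) : ℝ) : ℂ) * I := by
      simp only [betaJ, beta3]
      norm_num
      rw [hα]; field_simp; ring
    simpa [ffJ6, ffJ7, byJ, ff36, ff37] using
      key (-1) (by norm_num) _ hβ (by norm_num) (-3/2) (-1/2) (by norm_num) (by norm_num)


/-- `|ι₃| ≤ 1.25` and `|ι₄| ≤ 2.3` ((2.26): `ι₃ = −1.00635 − 0.22789i`, `ι₄ = −0.68738 + 1.60688i`).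
[cite: Zhang2022LandauSiegel, §2 (2.26)] -/
theorem norm_iota34_le : ‖iota3‖ ≤ 1.25 ∧ ‖iota4‖ ≤ 2.3 := by
  constructor
  · refine (Complex.norm_le_abs_re_add_abs_im _).trans ?_
    simp [iota3]
    norm_num [abs_of_nonneg, abs_of_nonpos]
  · refine (Complex.norm_le_abs_re_add_abs_im _).trans ?_
    simp [iota4]
    norm_num [abs_of_nonneg, abs_of_nonpos]

/-- `P^a = Ppow (log P) a` (`P = e^{𝓛⁹}`, so `log P = 𝓛⁹` and `P^a = e^{a𝓛⁹}`).
[cite: Zhang2022LandauSiegel, §2 (2.6)] -/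
theorem bigP_rpow_eq_Ppow (D : ℕ) (a : ℝ) : bigP D ^ a = Ppow (Real.log (bigP D)) a := by
  simp only [Ppow, bigP, Real.log_exp]
  exact (Real.exp_mul _ _).symm

/-- **The `x = P^z` substitution and the reflection `z ↦ 0.496 − z`, EXACT** (p. 60, tex L3081,
second → third line without the `𝔣 → 𝔣𝔣` replacement):
`lowX1214 = (𝔞β_{j+1}β_{j+2}log P/500)∫₀^{0.496}(ῑ₃𝔣(β_j,β₆;(0.002+z)log P)/0.498 +
ῑ₄𝔣(β_j,β₇;(0.004+z)log P)/0.5)dz`. [cite: Zhang2022LandauSiegel, §10 p. 60] -/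
theorem lowX1214_eq_z (c' : ℝ) {D : ℕ} [NeZero D] (χ : DirichletCharacter ℂ D) (j : ℕ)
    (hΛ : 0 ≤ Real.log (bigP D)) :
    lowX1214 c' χ j =
      (frakA χ : ℂ) * (betaJ c' D (j + 1) * betaJ c' D (j + 2)) * (Real.log (bigP D) : ℂ) / 500 *
        ∫ z in (0 : ℝ)..0.496,
          (conj iota3 * frakf (betaJ c' D j) (beta6 D)
              ((Real.log (bigP D) : ℂ) * (((0.002 + z : ℝ)) : ℂ)) / 0.498 +
            conj iota4 * frakf (betaJ c' D j) (beta7 D)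
              ((Real.log (bigP D) : ℂ) * (((0.004 + z : ℝ)) : ℂ)) / 0.5) := by
  set Λ : ℝ := Real.log (bigP D) with hΛdef
  have h6 : betaMu D 6 = beta6 D := by norm_num [betaMu]
  have h7 : betaMu D 7 = beta7 D := by norm_num [betaMu]
  unfold lowX1214 frakfW
  rw [h6, h7, bigP_rpow_eq_Ppow D 0.496, bigP_rpow_eq_Ppow D 0.498, bigP_rpow_eq_Ppow D 0.5,
    ← hΛdef,
    integral_one_Ppow' hΛ 0.496 (fun x => conj iota3 * frakf (betaJ c' D j) (beta6 D)
      (Real.log (Ppow Λ 0.498 / x) : ℂ) / 0.498 + conj iota4 * frakf (betaJ c' D j) (beta7 D)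
      (Real.log (Ppow Λ 0.5 / x) : ℂ) / 0.5),
    intervalIntegral.integral_congr
      (g := fun z => conj iota3 * frakf (betaJ c' D j) (beta6 D)
          ((Λ : ℂ) * (((0.002 + (0.496 - z) : ℝ)) : ℂ)) / 0.498 +
        conj iota4 * frakf (betaJ c' D j) (beta7 D)
          ((Λ : ℂ) * (((0.004 + (0.496 - z) : ℝ)) : ℂ)) / 0.5)
      fun z _ => by
        have e1 : (Λ * (0.498 - z) : ℝ) = Λ * (0.002 + (0.496 - z)) := by ring
        have e2 : (Λ * (0.5 - z) : ℝ) = Λ * (0.004 + (0.496 - z)) := by ring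
        simp only [log_Ppow_div_Ppow, e1, e2]
        push_cast
        ring_nf,
    integral_reflect (fun w => conj iota3 * frakf (betaJ c' D j) (beta6 D)
          ((Λ : ℂ) * (((0.002 + w : ℝ)) : ℂ)) / 0.498 +
        conj iota4 * frakf (betaJ c' D j) (beta7 D)
          ((Λ : ℂ) * (((0.004 + w : ℝ)) : ℂ)) / 0.5) 0.496]
  ring

/-- The scalar bookkeeping of the `o(α)` bound in `low1214Int_holds`. [folklore] -/
private theorem scal_identity (K E0 U A L : ℝ) (hA : A ≠ 0) :
    (K * L ^ 4) * (6 * A ^ 2 * (1 + E0)) * (π / A) / 500 * (9 * π * U) =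
      A * (54 * π ^ 2 / 500 * K * (1 + E0) * (U * L ^ 4)) := by
  field_simp
  ring

/-- The norm of the prefactor `𝔞β_{j+1}β_{j+2}log P/500` given `β_{j+1}β_{j+2} = −nα²(1+E)`:
`= 𝔞·nα²|1+E|·(π/α)/500`. [cite: Zhang2022LandauSiegel, §10 p. 60] -/
theorem norm_pref1214_eq (c' : ℝ) {D : ℕ} [NeZero D] (χ : DirichletCharacter ℂ D) {j n : ℕ}
    {E : ℝ} (hΛ : 0 < Real.log (bigP D))
    (hprod : betaJ c' D (j + 1) * betaJ c' D (j + 2) =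
      -((((n : ℝ) * alpha D ^ 2 * (1 + E) : ℝ)) : ℂ)) :
    ‖(frakA χ : ℂ) * (betaJ c' D (j + 1) * betaJ c' D (j + 2)) * (Real.log (bigP D) : ℂ) / 500‖ =
      frakA χ * ((n : ℝ) * alpha D ^ 2 * |1 + E|) * (π / alpha D) / 500 := by
  have hΛeq : Real.log (bigP D) = π / alpha D := by rw [alpha]; field_simp
  have hA0 : 0 ≤ frakA χ := frakA_nonneg χ
  have hα := alpha_pos hΛ
  have h500 : ‖(500 : ℂ)‖ = 500 := by norm_num
  rw [hprod, hΛeq, norm_div, norm_mul, norm_mul, norm_neg, Complex.norm_real, Complex.norm_real,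
    Complex.norm_real, Real.norm_of_nonneg hA0, Real.norm_eq_abs, Real.norm_of_nonneg
    (by positivity), abs_mul, abs_mul, abs_of_nonneg (by positivity : (0 : ℝ) ≤ n),
    abs_of_nonneg (by positivity : (0 : ℝ) ≤ alpha D ^ 2), h500]

/-- Pointwise bound for the `𝔣 → 𝔣𝔣` replacement in the low-range integrand of `S_j(𝐚₁₂,𝐚₁₄)`
(`0 ≤ z ≤ 0.496`): `≤ 18π|c′α𝓛|`. [cite: Zhang2022LandauSiegel, §10 p. 60] -/
theorem norm_lowIntegrand_sub_le (c' : ℝ) {D : ℕ} (hΛ : 0 < Real.log (bigP D)) {j : ℕ}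
    (hj : j ∈ ({1, 2, 3} : Finset ℕ)) {z : ℝ} (hz0 : 0 ≤ z) (hz1 : z ≤ 0.496) :
    ‖(conj iota3 * frakf (betaJ c' D j) (beta6 D)
          ((Real.log (bigP D) : ℂ) * (((0.002 + z : ℝ)) : ℂ)) / 0.498 +
        conj iota4 * frakf (betaJ c' D j) (beta7 D)
          ((Real.log (bigP D) : ℂ) * (((0.004 + z : ℝ)) : ℂ)) / 0.5) -
      (conj iota3 * ffJ6 j (0.002 + z) / 0.498 + conj iota4 * ffJ7 j (0.004 + z) / 0.5)‖ ≤
      18 * π * |c' * alpha D * ell D| := by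
  obtain ⟨hi3, hi4⟩ := norm_iota34_le
  obtain ⟨b6, -⟩ := norm_frakf_sub_ffJ (c' := c') hΛ hj (0.002 + z)
  obtain ⟨-, b7⟩ := norm_frakf_sub_ffJ (c' := c') hΛ hj (0.004 + z)
  have hw6 : |(0.002 : ℝ) + z| ≤ 0.5 := by rw [abs_of_nonneg (by linarith)]; linarith
  have hw7 : |(0.004 : ℝ) + z| ≤ 0.5 := by rw [abs_of_nonneg (by linarith)]; linarith
  have hU := abs_nonneg (c' * alpha D * ell D)
  have hπ0 := Real.pi_pos.le
  set U := |c' * alpha D * ell D| with hUdef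
  set X6 := frakf (betaJ c' D j) (beta6 D) ((Real.log (bigP D) : ℂ) * (((0.002 + z : ℝ)) : ℂ)) -
    ffJ6 j (0.002 + z) with hX6
  set X7 := frakf (betaJ c' D j) (beta7 D) ((Real.log (bigP D) : ℂ) * (((0.004 + z : ℝ)) : ℂ)) -
    ffJ7 j (0.004 + z) with hX7
  have b6' : ‖X6‖ ≤ 5 * π * U * 0.5 := b6.trans (mul_le_mul_of_nonneg_left hw6 (by positivity))
  have b7' : ‖X7‖ ≤ 5 * π * U * 0.5 := b7.trans (mul_le_mul_of_nonneg_left hw7 (by positivity))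
  have key : (conj iota3 * frakf (betaJ c' D j) (beta6 D)
          ((Real.log (bigP D) : ℂ) * (((0.002 + z : ℝ)) : ℂ)) / 0.498 +
        conj iota4 * frakf (betaJ c' D j) (beta7 D)
          ((Real.log (bigP D) : ℂ) * (((0.004 + z : ℝ)) : ℂ)) / 0.5) -
      (conj iota3 * ffJ6 j (0.002 + z) / 0.498 + conj iota4 * ffJ7 j (0.004 + z) / 0.5) =
      conj iota3 / 0.498 * X6 + conj iota4 / 0.5 * X7 := by
    rw [hX6, hX7]; ring
  rw [key]
  refine (norm_add_le _ _).trans ?_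
  have e498 : ‖(0.498 : ℂ)‖ = 0.498 := by norm_num
  have e5 : ‖(0.5 : ℂ)‖ = 0.5 := by norm_num
  rw [norm_mul, norm_mul, norm_div, norm_div, RCLike.norm_conj, RCLike.norm_conj, e498, e5]
  have h1 : ‖iota3‖ / 0.498 * ‖X6‖ ≤ 2.6 * (5 * π * U * 0.5) := by
    have : ‖iota3‖ / 0.498 ≤ 2.6 := by
      rw [div_le_iff₀ (by norm_num)]; linarith
    calc ‖iota3‖ / 0.498 * ‖X6‖ ≤ 2.6 * ‖X6‖ :=
          mul_le_mul_of_nonneg_right this (norm_nonneg _)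
      _ ≤ 2.6 * (5 * π * U * 0.5) := by gcongr
  have h2 : ‖iota4‖ / 0.5 * ‖X7‖ ≤ 4.6 * (5 * π * U * 0.5) := by
    have : ‖iota4‖ / 0.5 ≤ 4.6 := by
      rw [div_le_iff₀ (by norm_num)]; linarith
    calc ‖iota4‖ / 0.5 * ‖X7‖ ≤ 4.6 * ‖X7‖ :=
          mul_le_mul_of_nonneg_right this (norm_nonneg _)
      _ ≤ 4.6 * (5 * π * U * 0.5) := by gcongr
  nlinarith

/-- The integrated bound: `‖∫₀^{0.496}(𝔣-form) − ∫₀^{0.496}(𝔣𝔣-form)‖ ≤ 9π|c′α𝓛|`.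
[cite: Zhang2022LandauSiegel, §10 p. 60] -/
theorem norm_lowInt_sub_le (c' : ℝ) {D : ℕ} (hΛ : 0 < Real.log (bigP D)) {j : ℕ}
    (hj : j ∈ ({1, 2, 3} : Finset ℕ)) :
    ‖(∫ z in (0 : ℝ)..0.496, (conj iota3 * frakf (betaJ c' D j) (beta6 D)
            ((Real.log (bigP D) : ℂ) * (((0.002 + z : ℝ)) : ℂ)) / 0.498 +
          conj iota4 * frakf (betaJ c' D j) (beta7 D)
            ((Real.log (bigP D) : ℂ) * (((0.004 + z : ℝ)) : ℂ)) / 0.5)) -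
        ∫ z in (0 : ℝ)..0.496,
          (conj iota3 * ffJ6 j (0.002 + z) / 0.498 + conj iota4 * ffJ7 j (0.004 + z) / 0.5)‖ ≤
      9 * π * |c' * alpha D * ell D| := by
  have hcont1 : Continuous fun z : ℝ => conj iota3 * frakf (betaJ c' D j) (beta6 D)
        ((Real.log (bigP D) : ℂ) * (((0.002 + z : ℝ)) : ℂ)) / 0.498 +
      conj iota4 * frakf (betaJ c' D j) (beta7 D)
        ((Real.log (bigP D) : ℂ) * (((0.004 + z : ℝ)) : ℂ)) / 0.5 := by fun_prop
  have hcont2 : Continuous fun z : ℝ =>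
      conj iota3 * ffJ6 j (0.002 + z) / 0.498 + conj iota4 * ffJ7 j (0.004 + z) / 0.5 := by fun_prop
  rw [← integral_sub2 hcont1 hcont2]
  have h := intervalIntegral.norm_integral_le_of_norm_le_const (a := (0 : ℝ)) (b := 0.496)
    (C := 18 * π * |c' * alpha D * ell D|)
    (f := fun z => (conj iota3 * frakf (betaJ c' D j) (beta6 D)
            ((Real.log (bigP D) : ℂ) * (((0.002 + z : ℝ)) : ℂ)) / 0.498 +
          conj iota4 * frakf (betaJ c' D j) (beta7 D)
            ((Real.log (bigP D) : ℂ) * (((0.004 + z : ℝ)) : ℂ)) / 0.5) -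
        (conj iota3 * ffJ6 j (0.002 + z) / 0.498 + conj iota4 * ffJ7 j (0.004 + z) / 0.5))
    (fun z hz => by
      rw [Set.uIoc_of_le (by norm_num), Set.mem_Ioc] at hz
      exact norm_lowIntegrand_sub_le c' hΛ hj hz.1.le hz.2)
  refine h.trans ?_
  have h0496 : |(0.496 : ℝ) - 0| = 0.496 := by rw [sub_zero, abs_of_pos (by norm_num)]
  rw [h0496]
  nlinarith [Real.pi_pos, abs_nonneg (c' * alpha D * ell D)]

/-- **Z22:§10.u055 (iii) holds** [Z22 p.60, tex L3081, third line]: `Low1214Int c′` — "`… =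
(𝔞β_{j+1}β_{j+2}log P/500)∫₀^{0.496}(ῑ₃𝔣𝔣_{j6}(0.002 + z)/0.498 + ῑ₄𝔣𝔣_{j7}(0.004 + z)/0.5)dz + o(α)`":
the substitution `x = P^z` and the reflection are exact (`lowX1214_eq_z`), and replacing
`𝔣_{jμ}(P^w)` by `𝔣𝔣_{jμ}(w)` costs `≤ 5π|c′α𝓛|·|w|` pointwise (`norm_frakf_sub_ffJ`), in total
`≤ (6π/500)·𝔞α(1+|E_j|)·9π|c′α𝓛|`, which is `o(α)` since `𝔞 ≪ 𝓛⁴` (the tree's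
`Skeleton.frakA_le_ell_pow_four`) and `α𝓛 = π𝓛⁻⁸`; unconditional in (A).
[cite: Zhang2022LandauSiegel, §10 p. 60] -/
theorem low1214Int_holds (c' : ℝ) : Low1214Int c' := by
  intro ε hε
  obtain ⟨K, hK0, hAK⟩ : ∃ K : ℝ, 0 ≤ K ∧ ∀ (D : ℕ) [NeZero D] (χ : DirichletCharacter ℂ D),
      3 ≤ ell D → χ.IsPrimitive → frakA χ ≤ K * ell D ^ 4 :=
    ⟨_, by positivity, fun D _ χ h hp => frakA_le_ell_pow_four χ h hp⟩
  set E0 : ℝ := 6 * (|c'| * π) + 5 * (|c'| * π) ^ 2 with hE0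
  have hE00 : 0 ≤ E0 := by positivity
  set C : ℝ := 54 * π ^ 2 / 500 * K * (1 + E0) * (|c'| * π) + 1 with hC
  have hCm : 54 * π ^ 2 / 500 * K * (1 + E0) * (|c'| * π) ≤ C := by rw [hC]; linarith
  have hC1 : 1 ≤ C := by
    have : 0 ≤ 54 * π ^ 2 / 500 * K * (1 + E0) * (|c'| * π) := by positivity
    linarith
  have hC0 : 0 < C := by linarith
  refine ⟨max 21 ⌈Real.exp (C / ε + 1)⌉₊, fun D _ χ hD _ hp _ j hj => ?_⟩
  have hD21 : 21 ≤ D := le_trans (le_max_left _ _) hD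
  have hDexp : Real.exp (C / ε + 1) ≤ D :=
    le_trans (Nat.le_ceil _) (by exact_mod_cast le_trans (le_max_right _ _) hD)
  have hℓ3 : 3 < ell D := three_lt_log_of_le hD21
  have hℓ0 : 0 < ell D := by linarith
  have hℓ1 : 1 ≤ ell D := by linarith
  have hℓC : C / ε + 1 ≤ ell D := by
    rw [ell]; exact (Real.le_log_iff_exp_le (by positivity)).mpr hDexp
  have hΛ : 0 < Real.log (bigP D) := by rw [bigP, Real.log_exp]; positivity
  have hα := alpha_pos hΛ
  have hA0 : 0 ≤ frakA χ := frakA_nonneg χ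
  have hA : frakA χ ≤ K * ell D ^ 4 := hAK D χ hℓ3.le hp
  -- the `u = c'α𝓛` bookkeeping
  have hu : c' * alpha D * ell D = c' * π / ell D ^ 8 := by rw [mul_assoc, alpha_mul_ell hℓ0]; ring
  have hu8 : |c' * alpha D * ell D| ≤ |c'| * π := by
    rw [hu, abs_div, abs_mul, abs_of_pos Real.pi_pos, abs_of_pos (by positivity : 0 < ell D ^ 8)]
    exact div_le_self (by positivity) (one_le_pow₀ hℓ1)
  have hu4 : |c' * alpha D * ell D| * ell D ^ 4 = |c'| * π * (ell D ^ 4)⁻¹ := by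
    rw [hu, abs_div, abs_mul, abs_of_pos Real.pi_pos, abs_of_pos (by positivity : 0 < ell D ^ 8)]
    field_simp
  obtain ⟨n, E, -, hn, hE, hprod⟩ := betaJ_pair c' D hj
  have hE1 : |E| ≤ E0 := by
    refine hE.trans ?_
    rw [hE0]
    have : (c' * alpha D * ell D) ^ 2 ≤ (|c'| * π) ^ 2 := by
      rw [← sq_abs]; exact pow_le_pow_left₀ (abs_nonneg _) hu8 2
    linarith
  -- assemble
  rw [lowX1214_eq_z c' χ j hΛ.le, lowInt1214, ← mul_sub, norm_mul, norm_pref1214_eq c' χ hΛ hprod]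
  have hn6 : (n : ℝ) * alpha D ^ 2 * |1 + E| ≤ 6 * alpha D ^ 2 * (1 + E0) := by
    have : |1 + E| ≤ 1 + E0 := (abs_add_le _ _).trans (by rw [abs_one]; linarith)
    gcongr
  have hpref_le : frakA χ * ((n : ℝ) * alpha D ^ 2 * |1 + E|) * (π / alpha D) / 500 ≤
      (K * ell D ^ 4) * (6 * alpha D ^ 2 * (1 + E0)) * (π / alpha D) / 500 := by gcongr
  have hℓ4 : ell D ≤ ell D ^ 4 := by
    calc ell D = ell D ^ 1 := (pow_one _).symm
      _ ≤ ell D ^ 4 := pow_le_pow_right₀ hℓ1 (by norm_num)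
  have hfin : C * (ell D)⁻¹ ≤ ε := by
    rw [mul_inv_le_iff₀ hℓ0]
    have : C / ε ≤ ell D := by linarith
    rw [div_le_iff₀ hε] at this
    linarith
  refine (mul_le_mul hpref_le (norm_lowInt_sub_le c' hΛ hj) (norm_nonneg _) (by positivity)).trans ?_
  rw [scal_identity K E0 |c' * alpha D * ell D| (alpha D) (ell D) hα.ne', hu4]
  have step : 54 * π ^ 2 / 500 * K * (1 + E0) * (|c'| * π * (ell D ^ 4)⁻¹) ≤ ε := by
    calc 54 * π ^ 2 / 500 * K * (1 + E0) * (|c'| * π * (ell D ^ 4)⁻¹)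
        = (54 * π ^ 2 / 500 * K * (1 + E0) * (|c'| * π)) * (ell D ^ 4)⁻¹ := by ring
      _ ≤ C * (ell D ^ 4)⁻¹ := mul_le_mul_of_nonneg_right hCm (by positivity)
      _ ≤ C * (ell D)⁻¹ := by gcongr
      _ ≤ ε := hfin
  calc alpha D * (54 * π ^ 2 / 500 * K * (1 + E0) * (|c'| * π * (ell D ^ 4)⁻¹))
      ≤ alpha D * ε := mul_le_mul_of_nonneg_left step hα.le
    _ = ε * alpha D := mul_comm _ _

variable (c' : ℝ) in
/-- `Low1214Int` — `_holds` alias of `low1214Int_holds` above under the fact's exact name, stated under the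
prover's own binders as section variables (appended 2026-08-28, D-0026 bookkeeping: the proof term is the
existing theorem of this file; no statement, definition or attribute is edited; no new named fact; the
ledger's debt table listed the fact unproved). [cite: Zhang2022LandauSiegel, §10 p. 60] -/
theorem _root_.Literature.NumberTheory.LFunctions.Zhang2022.Typed.Sec10C.Low1214Int_holds :
    _root_.Literature.NumberTheory.LFunctions.Zhang2022.Typed.Sec10C.Low1214Int c' :=
  _root_.Literature.NumberTheory.LFunctions.Zhang2022.Typed.Sec10C.low1214Int_holds (c' := c')

end D34Low1214Int

end Literature.NumberTheory.LFunctions.Zhang2022.Typed.Sec10C
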